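import Summits.QuantumFields.YangMills.Theorems.UnitScaleTiltProp7BlockMeanContraction
import HarnessLib

/-!
# (q-gauge) «FR₂-lite» ROAD (route R2) — **THE FRAME-CORRECTED GAUGE PARAMETER KEEPS THE `(L^d)^{−k}` SITE-MASS CONTRACTION UP TO PER-LEVEL FACTORS `θ_j`: the `ℓ¹` step of a
# perturbed block `Ad`-average (F-A's pointwise letter summed over the blocks) and the k-level product `Σ_z ‖Λ_k z‖ ≤ ((L^d)⁻¹)^k·(∏_{j<k} θ_j)·Σ_x ‖Λ₀ x‖`**

Cell `ym3-torus` (HUMAN RULING D-0037, YM ladder rung R3 — SU(2) YM₃ on T³: NOT d = 4, NOT infinite volume, NOT a mass gap, NOT Clay).  Width seat `ym3-torus-px16` (gen 15);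
THEOREMS ONLY (0 `def`, 0 `sorry`, default heartbeats); `--supports stmt-QuantumFields-19200 --as helper`; count-neutral; NO claim on crux ∕ stub ∕ registry.

WHY.  Route R2 of the «FR₂-lite» LOCATE (19200 evidence #53∕#57): on the chart disc the frame-corrected parameter of the spike `δ_x⊗A` obeys, level by level, F-A's pointwise letter
(✓`Prop7CorrectedParamLevelBound.norm_correctedParam_level_le_sum`): `‖Λ_{j+1}(y)‖ ≤ α_j·|Idx|⁻¹Σ_i ‖Λ_j(x_i(y))‖ + β_j·Σ_{x∈B(y)} ‖Λ_j x‖` with `α_j = ‖w⁻¹‖‖w‖·p²` (frame and transporter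
norms, `≈ 1`) and `β_j = ‖w⁻¹‖·163·(1 + p²)·‖τ_j − 1‖` (first order in the GEOMETRIC tower closeness ✓`norm_tstairU_sub_one_le_geom_of_regPr`).  This file is the s-free bookkeeping that
turns those letters into the disc mass bound `Σ_z ‖Λ_k(s)(z)‖ ≤ ((L^d)⁻¹)^k·∏_j(α_j + β_j·L^d)·‖A‖` feeding Cauchy: §1 block letters, §2 the `ℓ¹` step (index mean = block mean, blocks tile the torus —
✓`Prop7BlockMeanContraction`), §3 the k-level product (the shape of ✓p780288 `Prop7AvgSeqSourcedMass` with factors instead of sources).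

WHAT IS PROVED (generic `P : Params`, normed ℂ-algebra `𝔸`; standing range `j + 1 ≤ m + K`).
* §1 `norm_apply_emb_le_sum_block`, `norm_apply_stair_le_sum_block` (a block site's value is below the block sum), `norm_sub_family_le` (sup norm of `i ↦ Λ₀ − a i`).
* §2 ★★ `sum_norm_correctedStep_le` — `Σ_y ‖Λ′ y‖ ≤ (α·(L^d)⁻¹ + β)·Σ_x ‖Λ x‖` from the pointwise letter.
* §3 ★★★ `sum_norm_correctedTower_le` — `Σ_z ‖Λ k z‖ ≤ ((L^d)⁻¹)^k·(∏_{j<k} θ j)·Σ_x ‖Λ 0 x‖` from per-level steps `Σ‖Λ (j+1)‖ ≤ (L^d)⁻¹·θ j·Σ‖Λ j‖`;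
  ★ `norm_correctedTower_le` — pointwise edition.
HONEST SCOPE.  Finite bookkeeping; the per-level letters (w5 g6 ✓`hasDerivAt_frameAccU_succ_at`, F-A, the closeness and frame norms), the analyticity∕Cauchy step and «FR₂-lite» are NOT here;
`hqG`, norm_H₁, norm_G, EX, the crux and rung R3 are NOT proved; the Yang–Mills mass gap is NOT proved.

References: T. Bałaban, CMP **98** (1985) 17–51 [Balaban1985Averaging] ((11) p.19, (97) p.32); CMP **99** (1985) 389–434 [Balaban1985BackgroundPropagators] ((3.19) p.393, (3.114)–(3.115)
p.418); CMP **109** (1987) 249–301 [Balaban1987RG1] ((0.3)–(0.4) pp.252–253).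
-/

set_option autoImplicit false

noncomputable section

open scoped BigOperators

namespace Summit.QuantumFields.YangMills.Theorems.Prop7CorrectedParamTowerMass

open Finset
open Literature.MathematicalPhysics.QuantumFieldTheory.Balaban1983to89
open T4Continuum BlockAveraging
open B10Eq27TorusAxialLog (transl)
open B7Prop1Explicit (disp)
open Summit.QuantumFields.YangMills.Theorems.LinearLiftGauge (sum_blockSite_eq)
open Summit.QuantumFields.YangMills.Theorems.Prop7BlockMeanContraction (transl_emb_disp_stairWord_eq_blockSite idxMean_eq_blockMean sum_sum_block_eq)

variable {P : Params} {𝔸 : Type*} [NormedRing 𝔸]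

/-! ## §1 Block letters -/

/-- the centre's value is below the block sum: `‖Λ(ŷ)‖ ≤ Σ_{x∈B(y)} ‖Λ x‖` (`ŷ ∈ B(y)`, ✓`Site.emb_mem_block`). [cite: Balaban1987RG1, (0.3) p.252] -/
theorem norm_apply_emb_le_sum_block {j : ℕ} (hj : j + 1 ≤ P.m + P.K) (Λ : Site P j → 𝔸) (y : Site P (j + 1)) :
    ‖Λ (emb y)‖ ≤ ∑ x ∈ block y, ‖Λ x‖ :=
  single_le_sum (f := fun x => ‖Λ x‖) (fun _ _ => norm_nonneg _) (Site.emb_mem_block hj y)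

/-- a stair end's value is below the block sum: `‖Λ(x_i(y))‖ ≤ Σ_{x∈B(y)} ‖Λ x‖` (`x_i(y) = blockSite y i.1 ∈ B(y)`). [cite: Balaban1987RG1, (0.3) p.252] -/
theorem norm_apply_stair_le_sum_block {j : ℕ} (hj : j + 1 ≤ P.m + P.K) (Λ : Site P j → 𝔸) (y : Site P (j + 1)) (i : Idx P) :
    ‖Λ (transl (emb y) (disp (stairWord i.2.1 (off i.1))))‖ ≤ ∑ x ∈ block y, ‖Λ x‖ := by
  rw [transl_emb_disp_stairWord_eq_blockSite]
  refine single_le_sum (f := fun x => ‖Λ x‖) (fun _ _ => norm_nonneg _) ?_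
  exact Finset.mem_filter.mpr ⟨Finset.mem_univ _, Site.blockOf_blockSite hj y i.1⟩

/-- sup norm of the family `i ↦ Λ₀ − a i`: `≤ ‖Λ₀‖ + B` when every `‖a i‖ ≤ B`. [folklore] -/
theorem norm_sub_family_le {ι : Type*} [Fintype ι] (Λ₀ : 𝔸) (a : ι → 𝔸) {B : ℝ} (hB : 0 ≤ B) (ha : ∀ i, ‖a i‖ ≤ B) :
    ‖(fun i : ι => Λ₀ - a i)‖ ≤ ‖Λ₀‖ + B := by
  refine (pi_norm_le_iff_of_nonneg (by positivity)).2 fun i => ?_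
  exact (norm_sub_le _ _).trans (by gcongr; exact ha i)

/-! ## §2 One level: the `ℓ¹` step of a perturbed block `Ad`-average -/

/-- ★★ **THE `ℓ¹` STEP**: if at every coarse site `‖Λ′ y‖ ≤ α·|Idx|⁻¹Σ_i ‖Λ(x_i(y))‖ + β·Σ_{x∈B(y)} ‖Λ x‖`, then `Σ_y ‖Λ′ y‖ ≤ (α·(L^d)⁻¹ + β)·Σ_x ‖Λ x‖` (any real `α, β`) — the index mean is the
block mean (✓`idxMean_eq_blockMean`, ✓`sum_blockSite_eq`) and the blocks tile the torus (✓`sum_sum_block_eq`).  With F-A's letter: `α = ‖w⁻¹‖‖w‖·p²`, `β = ‖w⁻¹‖·163·(1+p²)·‖τ − 1‖`.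
[cite: Balaban1985Averaging, (11) p.19, (97) p.32; Balaban1987RG1, (0.3)–(0.4) pp.252–253] -/
theorem sum_norm_correctedStep_le {j : ℕ} (hj : j + 1 ≤ P.m + P.K) (Λ : Site P j → 𝔸) (Λ' : Site P (j + 1) → 𝔸) {α β : ℝ}
    (hpt : ∀ y : Site P (j + 1), ‖Λ' y‖ ≤ α * ((Fintype.card (Idx P) : ℝ)⁻¹ * ∑ i : Idx P, ‖Λ (transl (emb y) (disp (stairWord i.2.1 (off i.1))))‖) + β * ∑ x ∈ block y, ‖Λ x‖) :
    ∑ y : Site P (j + 1), ‖Λ' y‖ ≤ (α * ((P.L : ℝ) ^ P.d)⁻¹ + β) * ∑ x : Site P j, ‖Λ x‖ := by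
  have hmean : ∀ y : Site P (j + 1), (Fintype.card (Idx P) : ℝ)⁻¹ * ∑ i : Idx P, ‖Λ (transl (emb y) (disp (stairWord i.2.1 (off i.1))))‖
      = ((P.L : ℝ) ^ P.d)⁻¹ * ∑ x ∈ block y, ‖Λ x‖ := fun y => by
    rw [idxMean_eq_blockMean (fun x => ‖Λ x‖) y, sum_blockSite_eq hj y (fun x => ‖Λ x‖)]
  calc ∑ y : Site P (j + 1), ‖Λ' y‖
      ≤ ∑ y : Site P (j + 1), (α * (((P.L : ℝ) ^ P.d)⁻¹ * ∑ x ∈ block y, ‖Λ x‖) + β * ∑ x ∈ block y, ‖Λ x‖) :=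
        sum_le_sum fun y _ => by rw [← hmean y]; exact hpt y
    _ = (α * ((P.L : ℝ) ^ P.d)⁻¹ + β) * ∑ y : Site P (j + 1), ∑ x ∈ block y, ‖Λ x‖ := by rw [mul_sum]; exact sum_congr rfl fun y _ => by ring
    _ = (α * ((P.L : ℝ) ^ P.d)⁻¹ + β) * ∑ x : Site P j, ‖Λ x‖ := by rw [sum_sum_block_eq]

/-! ## §3 k levels: the product of the per-level factors -/

/-- ★★★ **THE TOWER MASS BOUND**: per-level steps `Σ_y ‖Λ (j+1) y‖ ≤ (L^d)⁻¹·θ j·Σ_x ‖Λ j x‖` (`θ j ≥ 0`; §2 with `θ j = α_j + β_j·L^d`) give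
`Σ_z ‖Λ k z‖ ≤ ((L^d)⁻¹)^k·(∏_{j<k} θ j)·Σ_x ‖Λ 0 x‖` — for the spike `Λ 0 = δ_x⊗A` and `∏θ_j ≤ 2` (geometric closeness) this is `2·ℓ⁻³·‖A‖`, the disc bound Cauchy turns into «FR₂-lite».
[cite: Balaban1985Averaging, (97) p.32; Balaban1985BackgroundPropagators, (3.19) p.393, (3.114)–(3.115) p.418] -/
theorem sum_norm_correctedTower_le (Λ : (j : ℕ) → Site P j → 𝔸) (θ : ℕ → ℝ) (hθ : ∀ j, 0 ≤ θ j)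
    (hstep : ∀ j : ℕ, j + 1 ≤ P.m + P.K → ∑ y : Site P (j + 1), ‖Λ (j + 1) y‖ ≤ ((P.L : ℝ) ^ P.d)⁻¹ * θ j * ∑ x : Site P j, ‖Λ j x‖) :
    ∀ k : ℕ, k ≤ P.m + P.K → ∑ y : Site P k, ‖Λ k y‖ ≤ (((P.L : ℝ) ^ P.d)⁻¹) ^ k * (∏ j ∈ range k, θ j) * ∑ x : Site P 0, ‖Λ 0 x‖
  | 0, _ => by simp
  | k + 1, hk => by
    have ih := sum_norm_correctedTower_le Λ θ hθ hstep k (by omega)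
    have hL : 0 ≤ ((P.L : ℝ) ^ P.d)⁻¹ := by positivity
    have hprod : 0 ≤ ∏ j ∈ range k, θ j := prod_nonneg fun j _ => hθ j
    calc ∑ y : Site P (k + 1), ‖Λ (k + 1) y‖ ≤ ((P.L : ℝ) ^ P.d)⁻¹ * θ k * ∑ x : Site P k, ‖Λ k x‖ := hstep k hk
      _ ≤ ((P.L : ℝ) ^ P.d)⁻¹ * θ k * ((((P.L : ℝ) ^ P.d)⁻¹) ^ k * (∏ j ∈ range k, θ j) * ∑ x : Site P 0, ‖Λ 0 x‖) :=
          mul_le_mul_of_nonneg_left ih (mul_nonneg hL (hθ k))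
      _ = (((P.L : ℝ) ^ P.d)⁻¹) ^ (k + 1) * (∏ j ∈ range (k + 1), θ j) * ∑ x : Site P 0, ‖Λ 0 x‖ := by rw [prod_range_succ]; ring

/-- ★ **POINTWISE EDITION**: `‖Λ k z‖ ≤ ((L^d)⁻¹)^k·(∏_{j<k} θ j)·Σ_x ‖Λ 0 x‖` at every level-`k` site. [cite: Balaban1985Averaging, (97) p.32; Balaban1985BackgroundPropagators, (3.114)–(3.115) p.418] -/
theorem norm_correctedTower_le (Λ : (j : ℕ) → Site P j → 𝔸) (θ : ℕ → ℝ) (hθ : ∀ j, 0 ≤ θ j)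
    (hstep : ∀ j : ℕ, j + 1 ≤ P.m + P.K → ∑ y : Site P (j + 1), ‖Λ (j + 1) y‖ ≤ ((P.L : ℝ) ^ P.d)⁻¹ * θ j * ∑ x : Site P j, ‖Λ j x‖)
    {k : ℕ} (hk : k ≤ P.m + P.K) (z : Site P k) :
    ‖Λ k z‖ ≤ (((P.L : ℝ) ^ P.d)⁻¹) ^ k * (∏ j ∈ range k, θ j) * ∑ x : Site P 0, ‖Λ 0 x‖ :=
  (single_le_sum (fun y _ => norm_nonneg (Λ k y)) (mem_univ z)).trans (sum_norm_correctedTower_le Λ θ hθ hstep k hk)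

end Summit.QuantumFields.YangMills.Theorems.Prop7CorrectedParamTowerMass

end
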